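import Literature.MathematicalPhysics.QuantumFieldTheory.Balaban1983to89.B9SectBStepUStructuralKit

/-!
# Balaban [B9], Thm 3.4 p. 400 / Sect. B pp. 400–407 at `G = SU(N)` — THE (α3) FACE CLOSED DOWN TO PRINT's THEOREMS 3.2 ∕ 3.3:
# `SectBStepU` at the record's reading of print's class with the structural binders, the `SU(N)` facts AND the positivity data `MInv aInv aW`
# SUPPLIED from an ∃-THRESHOLD form of the guarded Thm-3.11∕3.3 input «`Δ_a(U)` invertible on the class» (pub-ymgap N06, seat dag-n06-c g18; count-neutral)

T. Bałaban, *Propagators for lattice gauge theories in a background field*, Commun. Math. Phys. **99** (1985) 389–434 [`Balaban1985BackgroundPropagators`, "B9"],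
Thm 3.4 p. 400, Sect. B pp. 400–407, Thm 3.3 p. 399, (3.27) p. 395, (3.35) p. 396, Thm 3.10 (3.105)–(3.106) p. 414, Thm 3.11 p. 416; [4] = T. Bałaban, *Propagators and
renormalization transformations for lattice gauge theories. II*, Commun. Math. Phys. **96** (1984) 223–250 [`Balaban1984PropagatorsII`], Lemma 2.1 (2.59)–(2.61) pp. 233–234.

statement-level skeleton of published theorems with citation tags; proofs where landed; nothing here is a claim about the Yang–Mills mass gap

WHY THIS FILE (cell context).  After `B9SectBStepUStructuralKit` (this seat, g18) the (α3) face of record displays, besides print's Theorems 3.2 ∕ 3.3 `h32 h33` and the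
sections `hι`, only: the group facts `hG hG1` (true at `SU(N)`), `hb₁`, the neighbour threshold `hM₀B`, and the POSITIVITY DATA `MInv aInv aW hMInv haInv haW hMd hMr`
together with the GUARDED input `hunitA : ∀ j α₀ U, MInv ≤ M → 0 < α₀ → M·α₀ ≤ aInv → U ∈ (3.35)_{c35}(α₀) → IsUnit Δ_a(U)` — print's «G(U) = Δ_a(U)⁻¹ exists on the class»
(Thm 3.3 via Thm 3.10 (3.106), Thm 3.11).  The Sect.-B step holds for ANY positive `(MInv, aInv, aW)` at which `hunitA` is available, so once that input is known in
the ∃-THRESHOLD form `∃ MInv₀ aInv > 0, ∀ MInv ≥ MInv₀, ∀ j α₀ U, …` (the shape in which dag-n06-j g31 derives it for section-carrying sub-families from lit-balaban's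
member assembler `B9Thm310DeltaAAtMemberOfCubeData.deltaA_at_member_of_cubeData`, INTENT-2 2026-08-29), the data are CHOSEN here: `MInv := max MInv₀ (max (2(d+1)+1)
(r_L+2))`, `aW := 1` — and `hG ∕ hG1` are the `SU(N) ≦ U(N)` facts.  This file is the composition; it imports nothing of dag-n06-j's (the ∃-form is a HYPOTHESIS `hA`
here, instantiated by the consumer with `hunitA_of_sections` or any other supplier).

WHAT IS PROVED (sorry-free; standard axioms; 0 `def`; nothing of [B9] asserted).
* `norm_le_one_of_mem_su` (‖u‖ = 1 ≤ 1 on `SU(N)`, `CStarRing.norm_of_mem_unitary`).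
* ★★★ `sectBStepU_C37GY_su_extraYPb_of_isUnit` ∕ ★★ `thm34U_C37GY_su_extraYPb_of_isUnit` — `B9SectBStepUStructuralKit.…_std` at `G := SU(N)`, `c35 := c35Y`, with
  `hG hG1 MInv aInv aW hMInv haInv haW hunitA hMd hMr` SUPPLIED from `hA` (the ∃-threshold form).  DISPLAYED: `hι` (sections), `hA`, `hb₁`, `hM₀B`, `h32 h33`; `b ιB C38` data.

HONEST SCOPE.  Composition and threshold arithmetic; nothing of [B9]'s estimates is asserted or proved here; `hA` is a displayed hypothesis of printed species (Thm 3.3 ∕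
3.11 on the class, thresholds existential) until a supplier is composed in; `h32 h33` stay displayed; NOT a node discharge; COUNT-NEUTRAL; N06 NOT discharged; nothing
continuum ∕ ℝ⁴ ∕ OS ∕ mass gap ∕ Clay.  Cell `pub-ymgap` (HUMAN RULING D-0062), Track A node N06 [B9], seat `pub-ymgap-dag-n06-c` g18, 2026-08-29.  NEW file; nothing
landed is modified.  Net new unproved facts: 0.
-/

noncomputable section

namespace Literature.MathematicalPhysics.QuantumFieldTheory.Balaban1983to89.B9SectBStepUClosedSU

open scoped Matrix.Norms.L2Operator
open B6Ineq2142KLevelV1 (β)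
open B9PinMembersKLevelV1 (MemberY geo9Y)
open B9PinGeometryKLevelV1 (c35Y)
open B9Eq360DeltaPrimeAY (AfldY)
open B7Prop2SpecialUnitary (specialUnitaryUnits specialUnitaryUnits_le_unitaryUnits)
open B9SectBCodedClassR (bg9YC extraYPb)
open B9SectBCodedReadingsUR (SectBStepU Thm34U)
open B9SectBKerFrameCodedYR (CinvY)
open B9SectBCodedClassGY (C37GY)
open B9Eq340TaxiContourLocalityY (rLB)
open B9GeoNbrCountKLevelV1 (nbrM₀Y)
open B9SectBStepUStructuralKit (sectBStepU_C37GY_unitary_extraYPb_d261Y_std thm34U_C37GY_unitary_extraYPb_d261Y_std)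
open Node00 (BlkY IBondY CfgY GAY GpY deltaAY parSymY parBY kernelFamilyS kernelFamilyB)

variable {d ℓ : ℕ} {hd : 1 ≤ d + 1} {hL : Odd (ℓ + 1) ∧ 1 < ℓ + 1} {b₀ b₁ : ℝ} {Mstar : ℕ}
variable {N : ℕ} {J : Type} (f : J → MemberY d ℓ hd hL b₀ b₁ Mstar) [∀ x : MemberY d ℓ hd hL b₀ b₁ Mstar, Fintype (geo9Y x).Site]
  [instDS : ∀ x : MemberY d ℓ hd hL b₀ b₁ Mstar, DecidableEq (geo9Y x).Site] [instNE : ∀ x : MemberY d ℓ hd hL b₀ b₁ Mstar, Nonempty (geo9Y x).Site]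
  {ι : Type} [Fintype ι] [DecidableEq ι] (b : Module.Basis ι ℝ (Matrix (Fin N) (Fin N) ℂ))
  (ιB : ∀ j : J, BlkY (f j).toKIdx → IBondY (f j).toKIdx)
  (C38 : ∀ j : J, ℝ → CfgY (Matrix (Fin N) (Fin N) ℂ) (f j).toKIdx → AfldY (Matrix (Fin N) (Fin N) ℂ) (f j).toKIdx → Prop)

/-- `SU(N)` is contracting in the operator norm: `‖u‖ ≤ 1` (indeed `= 1`). [cite: Balaban1985BackgroundPropagators, p.389 (G ⊂ U(N)), bookkeeping] -/
theorem norm_le_one_of_mem_su [Nonempty (Fin N)] (u : (Matrix (Fin N) (Fin N) ℂ)ˣ) (hu : u ∈ specialUnitaryUnits (Fin N)) :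
    ‖(u : Matrix (Fin N) (Fin N) ℂ)‖ ≤ 1 :=
  (CStarRing.norm_of_mem_unitary (B7Prop2Explicit.mem_unitaryUnits.1 (specialUnitaryUnits_le_unitaryUnits hu))).le

/-- ★★★ **THE (α3) FACE CLOSED DOWN TO THMS 3.2 ∕ 3.3 AND THE ∃-THRESHOLD INVERTIBILITY INPUT** (`G = SU(N)`, `c35 = c35Y`, `𝔸 = M_N(ℂ)`, `N ≥ 1`):
`SectBStepU` at the record's reading of print's class over the coded carrier, with the structural binders (`B9SectBStepUStructuralKit`), the `SU(N)` facts and the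
positivity data `MInv aInv aW` SUPPLIED — `MInv := max MInv₀ (max (2(d+1)+1) (r_L+2))`, `aW := 1` — from
`hA : ∃ MInv₀ aInv, 0 < MInv₀ ∧ 0 < aInv ∧ ∀ MInv ≥ MInv₀, ∀ j α₀ U, MInv ≤ M → 0 < α₀ → M·α₀ ≤ aInv → U ∈ (3.35) → IsUnit Δ_a(U)`.
DISPLAYED: `hι`, `hA`, `hb₁`, `hM₀B`, `h32`, `h33`. [cite: Balaban1985BackgroundPropagators, Thm 3.4 p.400, Sect. B pp.400–407, Thm 3.3 p.399, (3.106) p.414, Thm 3.11 p.416, (3.35) p.396; Balaban1984PropagatorsII, Lemma 2.1 (2.59)–(2.61) pp.233–234] -/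
theorem sectBStepU_C37GY_su_extraYPb_of_isUnit [Nonempty (Fin N)] [NormOneClass (Matrix (Fin N) (Fin N) ℂ)] [FiniteDimensional ℝ (Matrix (Fin N) (Fin N) ℂ)]
    (hι : ∀ (j : J) (s : BlkY (f j).toKIdx), β (f j).toKIdx.hN (f j).toKIdx.D (f j).toKIdx.hk (ιB j s) = s)
    (hA : ∃ MInv₀ aInv : ℝ, 0 < MInv₀ ∧ 0 < aInv ∧ ∀ MInv : ℝ, MInv₀ ≤ MInv →
      ∀ (j : J) (α₀ : ℝ) (U : CfgY (Matrix (Fin N) (Fin N) ℂ) (f j).toKIdx), MInv ≤ (geo9Y (f j)).M → 0 < α₀ → (geo9Y (f j)).M * α₀ ≤ aInv →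
        (bg9YC (Matrix (Fin N) (Fin N) ℂ) (specialUnitaryUnits (Fin N)) (extraYPb (Matrix (Fin N) (Fin N) ℂ) (specialUnitaryUnits (Fin N))) (f j)).Reg335 c35Y α₀ U →
        IsUnit (deltaAY (f j).toKIdx (parSymY (f j).toKIdx) (parBY (f j).toKIdx) (GpY (f j).toKIdx (parSymY (f j).toKIdx)) U))
    (hb₁ : 0 ≤ b₁) (hM₀B : nbrM₀Y d ℓ hd hL b₀ b₁ (2 * ((d : ℝ) + 1)) ≤ Mstar)
    (h32 : B9.Thm32Printed (d + 1) c35Y (fun j => geo9Y (f j))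
      (fun j => bg9YC (Matrix (Fin N) (Fin N) ℂ) (specialUnitaryUnits (Fin N)) (extraYPb (Matrix (Fin N) (Fin N) ℂ) (specialUnitaryUnits (Fin N))) (f j))
      (CinvY (extraYPb (Matrix (Fin N) (Fin N) ℂ) (specialUnitaryUnits (Fin N))) f (specialUnitaryUnits (Fin N)) (fun j => parSymY (f j).toKIdx)))
    (h33 : B9.Thm33Printed c35Y (fun j => geo9Y (f j))
      (fun j => bg9YC (Matrix (Fin N) (Fin N) ℂ) (specialUnitaryUnits (Fin N)) (extraYPb (Matrix (Fin N) (Fin N) ℂ) (specialUnitaryUnits (Fin N))) (f j))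
      (fun j => kernelFamilyS (f j).toKIdx (bg9YC (Matrix (Fin N) (Fin N) ℂ) (specialUnitaryUnits (Fin N)) (extraYPb (Matrix (Fin N) (Fin N) ℂ) (specialUnitaryUnits (Fin N))) (f j))
        (fun U => U) (GpY (f j).toKIdx (parSymY (f j).toKIdx)) (parSymY (f j).toKIdx))
      (fun j => kernelFamilyB (f j).toKIdx (bg9YC (Matrix (Fin N) (Fin N) ℂ) (specialUnitaryUnits (Fin N)) (extraYPb (Matrix (Fin N) (Fin N) ℂ) (specialUnitaryUnits (Fin N))) (f j))
        (fun U => U) (GAY (f j).toKIdx (parSymY (f j).toKIdx) (parBY (f j).toKIdx) (GpY (f j).toKIdx (parSymY (f j).toKIdx))) (parBY (f j).toKIdx))) :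
    SectBStepU (extraYPb (Matrix (Fin N) (Fin N) ℂ) (specialUnitaryUnits (Fin N))) f (d + 1) c35Y (specialUnitaryUnits (Fin N)) b (fun j => parSymY (f j).toKIdx)
      (fun j => GAY (f j).toKIdx (parSymY (f j).toKIdx) (parBY (f j).toKIdx) (GpY (f j).toKIdx (parSymY (f j).toKIdx))) (fun j => parBY (f j).toKIdx)
      (fun j => C37GY (specialUnitaryUnits (Fin N)) (f j) (ιB j) (4 * ((d : ℝ) + 1) * Real.exp (3 * (((d : ℝ) + 1) / 2)))) C38
      (CinvY (extraYPb (Matrix (Fin N) (Fin N) ℂ) (specialUnitaryUnits (Fin N))) f (specialUnitaryUnits (Fin N)) (fun j => parSymY (f j).toKIdx)) := by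
  obtain ⟨MInv₀, aInv, hMInv₀, haInv, H⟩ := hA
  have hMd : 2 * ((d : ℝ) + 1) < max MInv₀ (max (2 * ((d : ℝ) + 1) + 1) (rLB d ℓ + 2)) :=
    lt_of_lt_of_le (by linarith) ((le_max_left _ _).trans (le_max_right _ _))
  have hMr : rLB d ℓ + 1 < max MInv₀ (max (2 * ((d : ℝ) + 1) + 1) (rLB d ℓ + 2)) :=
    lt_of_lt_of_le (by linarith) ((le_max_right _ _).trans (le_max_right _ _))
  exact sectBStepU_C37GY_unitary_extraYPb_d261Y_std f c35Y (specialUnitaryUnits (Fin N)) b ιB C38 specialUnitaryUnits_le_unitaryUnits hι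
    (fun u hu => norm_le_one_of_mem_su u hu) (max MInv₀ (max (2 * ((d : ℝ) + 1) + 1) (rLB d ℓ + 2))) aInv 1
    (lt_of_lt_of_le hMInv₀ (le_max_left _ _)) haInv one_pos (fun j α₀ U hM hα ha hU => H _ (le_max_left _ _) j α₀ U hM hα ha hU) hb₁ hMd hM₀B hMr h32 h33

/-- ★★ Theorem 3.4 in U-letters at `SU(N)` with the same supplies (over `B9SectBStepUStructuralKit.thm34U_C37GY_unitary_extraYPb_d261Y_std`).
[cite: Balaban1985BackgroundPropagators, Thm 3.4 p.400, Thm 3.3 p.399, Thm 3.11 p.416; Balaban1984PropagatorsII, Lemma 2.1 p.234] -/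
theorem thm34U_C37GY_su_extraYPb_of_isUnit [Nonempty (Fin N)] [NormOneClass (Matrix (Fin N) (Fin N) ℂ)] [FiniteDimensional ℝ (Matrix (Fin N) (Fin N) ℂ)]
    (hι : ∀ (j : J) (s : BlkY (f j).toKIdx), β (f j).toKIdx.hN (f j).toKIdx.D (f j).toKIdx.hk (ιB j s) = s)
    (hA : ∃ MInv₀ aInv : ℝ, 0 < MInv₀ ∧ 0 < aInv ∧ ∀ MInv : ℝ, MInv₀ ≤ MInv →
      ∀ (j : J) (α₀ : ℝ) (U : CfgY (Matrix (Fin N) (Fin N) ℂ) (f j).toKIdx), MInv ≤ (geo9Y (f j)).M → 0 < α₀ → (geo9Y (f j)).M * α₀ ≤ aInv →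
        (bg9YC (Matrix (Fin N) (Fin N) ℂ) (specialUnitaryUnits (Fin N)) (extraYPb (Matrix (Fin N) (Fin N) ℂ) (specialUnitaryUnits (Fin N))) (f j)).Reg335 c35Y α₀ U →
        IsUnit (deltaAY (f j).toKIdx (parSymY (f j).toKIdx) (parBY (f j).toKIdx) (GpY (f j).toKIdx (parSymY (f j).toKIdx)) U))
    (hb₁ : 0 ≤ b₁) (hM₀B : nbrM₀Y d ℓ hd hL b₀ b₁ (2 * ((d : ℝ) + 1)) ≤ Mstar)
    (h32 : B9.Thm32Printed (d + 1) c35Y (fun j => geo9Y (f j))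
      (fun j => bg9YC (Matrix (Fin N) (Fin N) ℂ) (specialUnitaryUnits (Fin N)) (extraYPb (Matrix (Fin N) (Fin N) ℂ) (specialUnitaryUnits (Fin N))) (f j))
      (CinvY (extraYPb (Matrix (Fin N) (Fin N) ℂ) (specialUnitaryUnits (Fin N))) f (specialUnitaryUnits (Fin N)) (fun j => parSymY (f j).toKIdx)))
    (h33 : B9.Thm33Printed c35Y (fun j => geo9Y (f j))
      (fun j => bg9YC (Matrix (Fin N) (Fin N) ℂ) (specialUnitaryUnits (Fin N)) (extraYPb (Matrix (Fin N) (Fin N) ℂ) (specialUnitaryUnits (Fin N))) (f j))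
      (fun j => kernelFamilyS (f j).toKIdx (bg9YC (Matrix (Fin N) (Fin N) ℂ) (specialUnitaryUnits (Fin N)) (extraYPb (Matrix (Fin N) (Fin N) ℂ) (specialUnitaryUnits (Fin N))) (f j))
        (fun U => U) (GpY (f j).toKIdx (parSymY (f j).toKIdx)) (parSymY (f j).toKIdx))
      (fun j => kernelFamilyB (f j).toKIdx (bg9YC (Matrix (Fin N) (Fin N) ℂ) (specialUnitaryUnits (Fin N)) (extraYPb (Matrix (Fin N) (Fin N) ℂ) (specialUnitaryUnits (Fin N))) (f j))
        (fun U => U) (GAY (f j).toKIdx (parSymY (f j).toKIdx) (parBY (f j).toKIdx) (GpY (f j).toKIdx (parSymY (f j).toKIdx))) (parBY (f j).toKIdx))) :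
    Thm34U (extraYPb (Matrix (Fin N) (Fin N) ℂ) (specialUnitaryUnits (Fin N))) f c35Y (specialUnitaryUnits (Fin N)) b (fun j => parSymY (f j).toKIdx)
      (fun j => GAY (f j).toKIdx (parSymY (f j).toKIdx) (parBY (f j).toKIdx) (GpY (f j).toKIdx (parSymY (f j).toKIdx))) (fun j => parBY (f j).toKIdx)
      (fun j => C37GY (specialUnitaryUnits (Fin N)) (f j) (ιB j) (4 * ((d : ℝ) + 1) * Real.exp (3 * (((d : ℝ) + 1) / 2)))) C38 := by
  obtain ⟨MInv₀, aInv, hMInv₀, haInv, H⟩ := hA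
  have hMd : 2 * ((d : ℝ) + 1) < max MInv₀ (max (2 * ((d : ℝ) + 1) + 1) (rLB d ℓ + 2)) :=
    lt_of_lt_of_le (by linarith) ((le_max_left _ _).trans (le_max_right _ _))
  have hMr : rLB d ℓ + 1 < max MInv₀ (max (2 * ((d : ℝ) + 1) + 1) (rLB d ℓ + 2)) :=
    lt_of_lt_of_le (by linarith) ((le_max_right _ _).trans (le_max_right _ _))
  exact thm34U_C37GY_unitary_extraYPb_d261Y_std f c35Y (specialUnitaryUnits (Fin N)) b ιB C38 specialUnitaryUnits_le_unitaryUnits hι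
    (fun u hu => norm_le_one_of_mem_su u hu) (max MInv₀ (max (2 * ((d : ℝ) + 1) + 1) (rLB d ℓ + 2))) aInv 1
    (lt_of_lt_of_le hMInv₀ (le_max_left _ _)) haInv one_pos (fun j α₀ U hM hα ha hU => H _ (le_max_left _ _) j α₀ U hM hα ha hU) hb₁ hMd hM₀B hMr h32 h33

end Literature.MathematicalPhysics.QuantumFieldTheory.Balaban1983to89.B9SectBStepUClosedSU

end
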